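import Summits.Ventures.YMGap.RobustBall.StringTensionOnBallW
import HarnessLib

/-!
# Robust ball (Y2), area-law side — LINEAR CONFINEMENT OF THE STATIC POTENTIAL on the ball

HONEST FRAMING: venture file of the cell `pub-ymgap` (QuantumFields programme), track ROBUST-BALL, seat rb-p2 (g2).  Strong-coupling LATTICE
statements; nothing about the continuum, a spectral mass gap, or Clay.

WHAT.  `StringTensionOnBall(W)` bounds the STRING TENSION `σ = lim_R V(R)/R` of a limit state from below whenever `σ` exists — i.e. whenever BOTH
iterated limits exist (`V(R) = lim_T −log|W(R,T)|/T` for every `R`, then `lim_R V(R)/R`).  This file records the intermediate, weaker-input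
statement: under the same area law, the STATIC QUARK–ANTIQUARK POTENTIAL of every infinite-volume limit state of every member family satisfies
  `V(R) ≥ c R − log C²`   at every separation `R ≥ 1` at which it exists (`HasStaticPotential μ χ_N R V`),
with ONE pair `(C, c)`, `c > 0`, for the whole ball (`staticPotential_onBall`, tier-2 twin `staticPotential_onBallW`; the general lemma
`linear_le_of_hasAreaLawWith_of_hasStaticPotential` is Step 1 of the tree's `HasAreaLawWith.le_of_hasStringTension`, isolated).  The existence of
`V(R)` is a single `T → ∞` limit (for the Wilson action it follows from reflection positivity in the time direction alone); it is NOT claimed here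
for members.  `SU(2)`, `d = 4` instances: the `β_W = 1/3` ball `(3/10, 3/20)` and the `1×2`-rectangle family (`|τ| ≤ 1/2000`).
-/

noncomputable section

open MeasureTheory Filter Topology
open Literature.MathematicalPhysics.QuantumLattice
open Literature.MathematicalPhysics.QuantumFieldTheory hiding ZdEdge Site

namespace Summit.Ventures.YMGap.RobustBall

variable {d N : ℕ}

/-- **Linear lower bound on the static potential under an area law** (generic; Step 1 of the tree's `HasAreaLawWith.le_of_hasStringTension`,
Seiler LNP 159 §2 for the notions).  If `|W(R,T)| ≤ C^{2(R+T)} e^{−cRT}` for all `R, T ≥ 1` (`HasAreaLawWith μ χ C c`) and the static potential `V`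
exists at separation `R ≥ 1` (`HasStaticPotential μ χ R V`), then `c R − log C² ≤ V` (logarithms, divide by `T`, `T → ∞`; the eventual
non-vanishing of the loops excludes `C = 0`). [folklore] -/
theorem linear_le_of_hasAreaLawWith_of_hasStaticPotential {G : Type*} [Group G] [MeasurableSpace G] [NeZero d]
    {μ : Measure (LGConfig d G)} {χ : G → ℝ} {C c : ℝ} (h : HasAreaLawWith μ χ C c) {R : ℕ} (hR : 1 ≤ R) {V : ℝ}
    (hV : HasStaticPotential μ χ R V) : c * R - Real.log (C ^ 2) ≤ V := by
  obtain ⟨hne, hT⟩ := hV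
  by_cases hC : C = 0
  · exfalso
    obtain ⟨T, hneT, hT1⟩ := (hne.and (eventually_ge_atTop 1)).exists
    have hW := h R T hR hT1
    rw [hC, zero_pow (by omega), zero_mul] at hW
    exact hneT (abs_nonpos_iff.1 hW)
  have hbound : ∀ᶠ T : ℕ in atTop, c * R - ((R : ℝ) / T + 1) * Real.log (C ^ 2) ≤
      -Real.log |rectExpectation μ χ 0 1 R T| / T := by
    filter_upwards [hne, eventually_ge_atTop 1] with T hneT hT1
    have hTpos : (0 : ℝ) < T := by exact_mod_cast hT1
    have hWpos : 0 < |rectExpectation μ χ 0 1 R T| := abs_pos.2 hneT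
    have hlog : Real.log |rectExpectation μ χ 0 1 R T| ≤ ((R : ℝ) + T) * Real.log (C ^ 2) + -c * R * T := by
      have := Real.log_le_log hWpos (h R T hR hT1)
      rwa [Real.log_mul (pow_ne_zero _ hC) (Real.exp_pos _).ne', Real.log_exp, pow_mul, Real.log_pow, Nat.cast_add] at this
    rw [le_div_iff₀ hTpos]
    have hRT : ((R : ℝ) / T + 1) * Real.log (C ^ 2) * T = ((R : ℝ) + T) * Real.log (C ^ 2) := by field_simp
    rw [sub_mul, hRT]
    linarith
  have hlow : Tendsto (fun T : ℕ => c * R - ((R : ℝ) / T + 1) * Real.log (C ^ 2)) atTop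
      (𝓝 (c * R - (0 + 1) * Real.log (C ^ 2))) :=
    tendsto_const_nhds.sub (((tendsto_const_div_atTop_nhds_zero_nat _).add_const _).mul_const _)
  rw [zero_add, one_mul] at hlow
  exact le_of_tendsto_of_tendsto hlow hT hbound

/-- **LINEAR CONFINEMENT OF THE STATIC POTENTIAL ON THE BALL.**  Under `AreaLawOnBall N d β ε₀ ε₁ r mv` (`d ≥ 2`) there is ONE pair `(C, c)`,
`c > 0`, such that for every infinite-volume limit state `μ` of every eventually-member family and every separation `R ≥ 1` at which the static
potential of `μ` exists (`HasStaticPotential μ χ_N R V`), `c R − log C² ≤ V`; and `HasAreaLawWith μ χ_N C c`.  Existence of `V(R)` is NOT asserted.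
[folklore] -/
theorem staticPotential_onBall [NeZero d] (hd : 2 ≤ d) {β ε₀ ε₁ : ℝ} {r mv : ℕ} (h : AreaLawOnBall N d β ε₀ ε₁ r mv) :
    ∃ C c : ℝ, 0 < c ∧ ∀ 𝓦 : PerturbationFamily d N,
      (∀ᶠ L : ℕ in atTop, 𝓦 L ∈ ClusterDomainFR ε₀ ε₁ r ∧ IsSlabLocal mv (𝓦 L)) →
        ∀ μ ∈ perturbedLimitPoints β 𝓦,
          HasAreaLawWith μ (fun g => normalisedCharacter N (fundamentalRep (Fin N) g)) C c ∧
          ∀ (R : ℕ), 1 ≤ R → ∀ V : ℝ,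
            HasStaticPotential μ (fun g => normalisedCharacter N (fundamentalRep (Fin N) g)) R V → c * R - Real.log (C ^ 2) ≤ V := by
  obtain ⟨C, c, hc, hA⟩ := hasAreaLawWith_onBall hd h
  exact ⟨C, c, hc, fun 𝓦 h𝓦 μ hμ => ⟨hA 𝓦 h𝓦 μ hμ, fun R hR V hV =>
    linear_le_of_hasAreaLawWith_of_hasStaticPotential (hA 𝓦 h𝓦 μ hμ) hR hV⟩⟩

/-- **LINEAR CONFINEMENT OF THE STATIC POTENTIAL ON THE TIER-2 BALL** (`AreaLawOnBallW`, diameter-weighted ball, no range cut-off): the same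
conclusion. [folklore] -/
theorem staticPotential_onBallW [NeZero d] (hd : 2 ≤ d) {β κ ε₀ ε₁ : ℝ} {mv : ℕ} (h : AreaLawOnBallW N d β κ ε₀ ε₁ mv) :
    ∃ C c : ℝ, 0 < c ∧ ∀ 𝓦 : PerturbationFamily d N,
      (∀ᶠ L : ℕ in atTop, 𝓦 L ∈ ClusterDomain κ ε₀ ε₁ ∧ IsSlabLocal mv (𝓦 L)) →
        ∀ μ ∈ perturbedLimitPoints β 𝓦,
          HasAreaLawWith μ (fun g => normalisedCharacter N (fundamentalRep (Fin N) g)) C c ∧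
          ∀ (R : ℕ), 1 ≤ R → ∀ V : ℝ,
            HasStaticPotential μ (fun g => normalisedCharacter N (fundamentalRep (Fin N) g)) R V → c * R - Real.log (C ^ 2) ≤ V := by
  obtain ⟨C, c, hc, hA⟩ := hasAreaLawWith_onBallW hd h
  exact ⟨C, c, hc, fun 𝓦 h𝓦 μ hμ => ⟨hA 𝓦 h𝓦 μ hμ, fun R hR V hV =>
    linear_le_of_hasAreaLawWith_of_hasStaticPotential (hA 𝓦 h𝓦 μ hμ) hR hV⟩⟩

/-! ### `SU(2)`, `d = 4` instances -/

/-- **`SU(2)`, `d = 4`, `β_W = 1/3`, ball `(3/10, 3/20)`**: one slope `c > 0` and one constant `C` such that the static potential of every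
infinite-volume limit state of every eventually-member family satisfies `V(R) ≥ cR − log C²` wherever it exists (input: g0's
`su2_areaLawOnBall_oneThird_vertex`). [folklore] -/
theorem su2_staticPotential_onBall_oneThird (r : ℕ) {mv : ℕ} (hmv : 1 ≤ mv) :
    ∃ C c : ℝ, 0 < c ∧ ∀ 𝓦 : PerturbationFamily 4 2,
      (∀ᶠ L : ℕ in atTop, 𝓦 L ∈ ClusterDomainFR (3 / 10) (3 / 20) r ∧ IsSlabLocal mv (𝓦 L)) →
        ∀ μ ∈ perturbedLimitPoints (1 / 6) 𝓦,
          HasAreaLawWith μ (fun g => normalisedCharacter 2 (fundamentalRep (Fin 2) g)) C c ∧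
          ∀ (R : ℕ), 1 ≤ R → ∀ V : ℝ,
            HasStaticPotential μ (fun g => normalisedCharacter 2 (fundamentalRep (Fin 2) g)) R V → c * R - Real.log (C ^ 2) ≤ V :=
  staticPotential_onBall (by norm_num) (su2_areaLawOnBall_oneThird_vertex r hmv)

/-- **The rectangle-perturbed `SU(2)` action at `β_W = 1/3` (`|τ| ≤ 1/2000`): linear confinement of the static potential in every infinite-volume
limit state** (the set of limit states is non-empty): `V(R) ≥ cR − log C²` wherever `V(R)` exists. [folklore] -/
theorem su2_rectangle_staticPotential_oneThird (τ : ℝ) (hτ : |τ| ≤ 1 / 2000) :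
    ∃ C c : ℝ, 0 < c ∧
      (perturbedLimitPoints (1 / 6) (fun L : ℕ => termPerturbation (rectFamily 4 (L + 1) 2 τ))).Nonempty ∧
      ∀ μ ∈ perturbedLimitPoints (1 / 6) (fun L : ℕ => termPerturbation (rectFamily 4 (L + 1) 2 τ)),
        HasAreaLawWith μ (fun g => normalisedCharacter 2 (fundamentalRep (Fin 2) g)) C c ∧
        ∀ (R : ℕ), 1 ≤ R → ∀ V : ℝ,
          HasStaticPotential μ (fun g => normalisedCharacter 2 (fundamentalRep (Fin 2) g)) R V → c * R - Real.log (C ^ 2) ≤ V := by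
  obtain ⟨C, c, hc, hA⟩ := su2_staticPotential_onBall_oneThird 2 (mv := 2) (by norm_num)
  exact ⟨C, c, hc, perturbedLimitPoints_nonempty _ _, hA _ (rectangle_eventually_mem τ hτ)⟩

end Summit.Ventures.YMGap.RobustBall

end
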